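import Summits.Ventures.Crystal3D.Theorems.StickyWulffConstantCoaxialWallLawTailResidueDefs2
import Summits.Ventures.Crystal3D.Theorems.StickyWulffConstantCoaxialWallLawEndRowIntReadings
import HarnessLib

/-!
# Type soundness II: the TRIVIAL TYPE and the reduction to windows with a positive summand
# (crux `CoaxialWallLaw`, stmt-Ventures-19481, line `WallLedgerF`; T4 brick, census-free)

HONEST FRAMING. Venture `Summits/Ventures/Crystal3D` (cell `crystal3d-full`); helper `--supports` the crux `CoaxialWallLaw`
(stmt-Ventures-19481, `route-Ventures-StickyWulffConstant`), REGISTERED line `WallLedgerF` (planner cf-p1, (xcv)(1): T4 pieces first).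
Census-free; F-C1 not moved.  The first (bookkeeping) step of `TailTypeSoundness₂` (`…TailResidueDefs2`):
* `trivialType` (`occ = {0}`, no fillers, no junction), `trivialType_wellFormed₂`, `trivialType_realise`, `trivialType_realisable₂`;
* `norm_eq_one_of_adm_basalSystem` (admissible directions of a basal system are unit vectors), `endMultFlat_singleton_basal`
  (a one-ball configuration has no flat end pairs), `rowJoint_trivialType` (`= 0` at every placement);
* `localSummandA_nonneg`, `exists_endPairA_of_localSummandA_pos` (a positive summand has an (A)-end pair `(b, q)` with `b` within
  `1` of the payer);
* **`tailTypeSoundness₂_of_pos`** — `TailTypeSoundness₂` follows from its restriction to windows with a POSITIVE joint summand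
  (the zero case is discharged by the trivial type at the identity placement).
WHAT THIS IS NOT: not type soundness itself; F-C1 not moved.
-/

noncomputable section

namespace Summit.Ventures.Crystal3D.Theorems

namespace TailResidue

open Summit.Ventures.Crystal3D Finset
open scoped InnerProductSpace

/-! ### The trivial type -/

/-- The trivial type: the payer alone. -/
def trivialType : ResidueType := ⟨{(0, 0, 0)}, [], none⟩

/-- The trivial type is well formed (II). -/
theorem trivialType_wellFormed₂ : trivialType.WellFormed₂ := by
  refine ⟨?_, by simp [trivialType], ?_, ?_, by simp [trivialType], ?_, ?_⟩
  · intro s hs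
    simp only [trivialType, Finset.mem_singleton] at hs
    subst hs
    simp [siteBall, dsq12]
  · intro s hs t ht hne
    simp only [trivialType, Finset.mem_singleton] at hs ht
    exact absurd (hs.trans ht.symm) hne
  · exact (Finset.card_filter_le _ _).trans (by simp [trivialType])
  · intro f hf
    simp [trivialType] at hf
  · exact trivial

/-- The exact balls of the trivial type: the payer. -/
theorem trivialType_realise : trivialType.realise = {modSite (0, 0, 0)} := by
  simp [ResidueType.realise, trivialType]

/-- The trivial type is realisable (II). -/
theorem trivialType_realisable₂ : trivialType.Realisable₂ := by
  refine ⟨?_, ?_, ?_⟩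
  · intro p hp q hq hne
    rw [trivialType_realise, Finset.mem_singleton] at hp hq
    exact absurd (hp.trans hq.symm) hne
  · intro f hf
    simp [trivialType] at hf
  · intro f hf
    simp [trivialType] at hf

/-! ### One ball has no flat end pairs -/

/-- Admissible directions of a basal system are unit vectors. -/
theorem norm_eq_one_of_adm_basalSystem {L G : EuclideanSpace ℝ (Fin 3) ≃ₗᵢ[ℝ] EuclideanSpace ℝ (Fin 3)}
    {d : EuclideanSpace ℝ (Fin 3)} (h : (basalSystem L).Adm G d) : ‖d‖ = 1 := by
  obtain ⟨r, hr, κ, -, -, rfl⟩ := h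
  have hr' : r ∈ fccSlots := (Finset.mem_filter.1 hr).1
  rw [LinearIsometryEquiv.norm_map, norm_smul, norm_pow, norm_neg, norm_one, one_pow, one_mul,
    norm_eq_one_of_mem_fccSlots hr']

/-- **A one-ball configuration has no flat end pairs** (for basal systems). -/
theorem endMultFlat_singleton_basal (v : WordVersion) (L L' : EuclideanSpace ℝ (Fin 3) ≃ₗᵢ[ℝ] EuclideanSpace ℝ (Fin 3))
    (x b : EuclideanSpace ℝ (Fin 3)) : endMultFlat {x} v (basalSystem L) (basalSystem L') b = 0 := by
  classical
  rw [endMultFlat, Finset.card_eq_zero, Finset.filter_eq_empty_iff]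
  intro q hq hpair
  obtain ⟨-, -, G, d, hadm, hqd, -⟩ := hpair
  rw [Finset.mem_singleton] at hq hqd
  have hd : ‖d‖ = 1 := by
    rcases hadm with h | h
    · exact norm_eq_one_of_adm_basalSystem h
    · exact norm_eq_one_of_adm_basalSystem h
  rw [hq, sub_eq_self] at hqd
  rw [hqd, norm_zero] at hd
  exact zero_ne_one hd

/-- **The trivial type has joint row `0` at every placement.** -/
theorem rowJoint_trivialType (L₀ : EuclideanSpace ℝ (Fin 3) ≃ₗᵢ[ℝ] EuclideanSpace ℝ (Fin 3)) : trivialType.rowJoint L₀ = 0 := by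
  rw [ResidueType.rowJoint, localSummandFlatDec, trivialType_realise]
  apply Finset.sum_eq_zero
  intro b hb
  rw [Finset.mem_filter, endMultFlat_singleton_basal] at hb
  exact absurd hb.2.2 (lt_irrefl 0)

/-! ### The reduction -/

/-- The (A) summand is nonnegative. -/
theorem localSummandA_nonneg (v : WordVersion) (S₁ S₂ : PlateSystem) (X : Finset (EuclideanSpace ℝ (Fin 3)))
    (z : EuclideanSpace ℝ (Fin 3)) : 0 ≤ localSummandA v S₁ S₂ X z :=
  Finset.sum_nonneg fun b _ => div_nonneg (Nat.cast_nonneg _) (EndRowFloor.pooledDef_nonneg X b)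

/-- A positive summand has an (A)-end pair `(b, q)` with `b` within `1` of the payer. -/
theorem exists_endPairA_of_localSummandA_pos {v : WordVersion} {S₁ S₂ : PlateSystem} {X : Finset (EuclideanSpace ℝ (Fin 3))}
    {z : EuclideanSpace ℝ (Fin 3)} (h : 0 < localSummandA v S₁ S₂ X z) :
    ∃ b ∈ X, dist z b ≤ 1 ∧ ∃ q, IsEndPairA X v S₁ S₂ b q := by
  classical
  rw [localSummandA] at h
  obtain ⟨b, hb, -⟩ := Finset.exists_ne_zero_of_sum_ne_zero h.ne'
  rw [Finset.mem_filter] at hb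
  obtain ⟨hbX, hzb, hpos⟩ := hb
  rw [endMultA, Finset.card_pos] at hpos
  obtain ⟨q, hq⟩ := hpos
  exact ⟨b, hbX, hzb, q, (Finset.mem_filter.1 hq).2⟩

/-- **THE REDUCTION**: `TailTypeSoundness₂` follows from its restriction to windows with a positive joint summand. -/
theorem tailTypeSoundness₂_of_pos
    (h : ∀ L : EuclideanSpace ℝ (Fin 3) ≃ₗᵢ[ℝ] EuclideanSpace ℝ (Fin 3),
      ∀ X : Finset (EuclideanSpace ℝ (Fin 3)), (∀ p ∈ X, ∀ q ∈ X, p ≠ q → 1 ≤ dist p q) →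
      ∀ z ∈ X, (X.filter fun q => dist z q = 1).card ≤ 11 → ¬ OnSiteAt coaxialModuleUniverse X z →
        0 < localSummandA WordVersion.v2 (basalSystem L)
          (basalSystem (((ℝ ∙ EuclideanSpace.single (2 : Fin 3) (1 : ℝ)).reflection).trans L)) X z →
        HasDeletionOnSite X z ∨ ∃ τ : ResidueType, τ.WellFormed₂ ∧ τ.Realisable₂ ∧
          ∃ L₀ : EuclideanSpace ℝ (Fin 3) ≃ₗᵢ[ℝ] EuclideanSpace ℝ (Fin 3), StdFrame L₀ ∧
            localSummandA WordVersion.v2 (basalSystem L)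
              (basalSystem (((ℝ ∙ EuclideanSpace.single (2 : Fin 3) (1 : ℝ)).reflection).trans L)) X z ≤ τ.rowJoint L₀) :
    TailTypeSoundness₂ := by
  intro L X hX z hz hdeg hoff
  rcases (localSummandA_nonneg WordVersion.v2 (basalSystem L)
    (basalSystem (((ℝ ∙ EuclideanSpace.single (2 : Fin 3) (1 : ℝ)).reflection).trans L)) X z).eq_or_lt with h0 | hpos
  · right
    refine ⟨trivialType, trivialType_wellFormed₂, trivialType_realisable₂, LinearIsometryEquiv.refl ℝ _, Or.inl (by simp), ?_⟩
    rw [← h0, rowJoint_trivialType]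
  · exact h L X hX z hz hdeg hoff hpos

end TailResidue

end Summit.Ventures.Crystal3D.Theorems

end
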